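import Summits.QuantumFields.BalabanUV.Beta.GAN24.ContactLambdaCellFactorised
import Summits.QuantumFields.BalabanUV.Beta.GAN24.SymContactLambdaCommutator
import Summits.QuantumFields.BalabanUV.Beta.GAN24.SymPush3LambdaKernelCells

/-!
# `BalabanUV.Beta.GAN24.SymContactLambdaCellFactorised` — binder row G-an2-4 ∕ (CONV-C), TRANSFER-III, the (III′) S-slot (b) of the END, born-Λ contact letter `hCg` (road-P2 M.104's
# 3rd hypothesis), TABLE HALF («mksym lane»), PART 7: **THE Λ CONTACT DIFFERENCE AT an1's SYMMETRISED HESSIAN, FACTORISED OVER THE COARSE BOND** — the twin of leaf-02 g48's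
# `ContactLambdaCellFactorised` §3–§4 (`tsum_sum_leg_mul_lambdaKernel`, `cellLambda_eq_sum_bracket_mul_commutator`, `contact_lambda_eq_factorised`) with `hessFFAt ↦ symHessFFAt`,
# `linKerAt ↦ symLinKerAt`, `linAvgAt ↦ symLinAvgAt` (and `(2L^{d+1})⁻¹ ↦ (2·((d+1)!·L^{d+1}))⁻¹`, the normalisation of an1's `q¹_sym`), over MY PARTs 3 (`SymContactLambdaCommutator`)
# and 6 (`SymPush3LambdaKernelCells`); leaf-02's generic exchange ∕ bracket lemmas (`tsum_sum_mul_sum_tsum_comm`, `summable_idxLeg_mul_coeff`, `abs_bracket_le`,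
# `tsum_sum_idxLeg_mul_neg_sum_tsum`, `bracket_eq_of_tent`) are table-free and are used BY NAME
# (G-an2-4 CRUX TEAM (2), leaf prover `b2b-balaban-gan24-formalise-leaf-01`, gen 90)

WHAT IS PROVED (generic `d`, box root `ρ = toSite r`; [folklore]):
* `tsum_sum_leg_mul_lambdaKernel` `Σ'_z Σ_b R b z·KΛ_sym(ψ; a; b,z) = −(2·((d+1)!·L^{d+1}))⁻¹·Σ_μ Σ'_y a μ y·(symLinAvgAt ρ (ψ̄•R) L μ y − Ψ̄_ρ(μ,y)·symLinAvgAt ρ R L μ y)`.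
* `cellLambda_eq_sum_bracket_mul_commutator`, **`contact_lambda_eq_factorised`**: `push₃ lᴱ rᴱ wᴱ SΛ − push₃ lᴮ rᴮ wᴮ SΛ` (`SΛ = SLam L c symHessFFAt`, field entries) as the two factorised cells
  `bracket × [𝒬^ρ_{L,sym}, λ̄] leg`.
NOT HERE: the entry bound (PART 8 `SymContactLambdaEntryBound`), any count.

NOT IN PRINT; OUR BOOKKEEPING ([folklore]; 0 `def`, 0 cited fact, 0 `def … : Prop`, 0 sorry).  HONEST FRAMING (cell contract, verbatim): «discharging `BetaPertH` makes
Bałaban's UV stability UNCONDITIONAL — a real constructive-QFT result; it is NOT the continuum limit and NOT the Clay problem.»  HONEST DEPENDENCY (verbatim): «continuum YM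
on T⁴ ⇐ BetaPertH ∧ nine spine estimates (0/9 proved); BetaPertH ⇐ (D1) ∧ (D4) ∧ CAP+tail; G-an2-4 gates asym, D1 and NE2/3/4.»  Discharges NO letter of M.104 by itself;
NEVER «G-an2-4 closed» as (CONV-C); NOT D1, NOT `BetaPertH`, NOT continuum, NOT Clay.  2026-08-28; no existing file touched.
-/

open Finset
open scoped BigOperators
open Literature.MathematicalPhysics.QuantumFieldTheory.LatticeForm (quo)
open Literature.MathematicalPhysics.QuantumFieldTheory.Balaban1983to89
open Literature.MathematicalPhysics.QuantumFieldTheory.Balaban1983to89.Beta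
open AffineAveraging AveragingContours AveragingHessianKernels AveragingContoursRooted AveragingHessianKernelsRooted
open B12Sec2to5 (l1 l1_nonneg)
open ExpKernelCalculus (Zl Zl_nonneg Zl_pos l1_sub_triangle l1_sub_symm summable_exp_shift tsum_exp_shift)
open InterLevelTransport (SLam)
open KernelWard (divV)
open Summit.QuantumFields.BalabanUV.Beta.LinearGaugeVH (nearBox mem_nearBox summable_of_finsupp)
open Summit.QuantumFields.BalabanUV.Beta.GAN24.ContactBorderPartner (exists_finset_near_card l1_smul_sub_le_of_mem
  l1_farEnd_sub_le_of_mem)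
open Summit.QuantumFields.BalabanUV.Beta.GAN24.ContactOneGaugeCellLambda (l1_root_sub_le_of_mem)
open Summit.QuantumFields.BalabanUV.Beta.SymmetrisedAxialPotential (symLinAvgAt)
open Summit.QuantumFields.BalabanUV.Beta.SymAveragingHessianCounts (symHessFFAt symLinKerAt symLinKerAt_eq_zero abs_symLinKerAt_le)
open Summit.QuantumFields.BalabanUV.Beta.GAN24.Push3 (push₃)
open Summit.QuantumFields.BalabanUV.Beta.GAN24.SymPush3LambdaKernelCells (contact_lambda_eq_cells)
open Summit.QuantumFields.BalabanUV.Beta.GAN24.ContactLambdaCommutator (abs_gaugeWeight_le prox_of_near)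
open Summit.QuantumFields.BalabanUV.Beta.GAN24.SymContactLambdaCommutator (tsum_sum_mul_gaugeWeight_mul_symLinKerAt)
open Summit.QuantumFields.BalabanUV.Beta.GAN24.ContactLambdaCellFactorised (tsum_sum_mul_sum_tsum_comm summable_idxLeg_mul_coeff abs_bracket_le tsum_sum_idxLeg_mul_neg_sum_tsum)

noncomputable section

namespace Summit.QuantumFields.BalabanUV.Beta.GAN24.SymContactLambdaCellFactorised

variable {d : ℕ}

/-! ## §3 The dominated exchange of the leg sum with the coarse coefficient sum; the Λ kernel against a leg -/

section Exchange

variable {L : ℕ} {r : Fin (d + 1) → ℕ}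

/-- [folklore] **THE Λ CONTACT KERNEL AGAINST A LEG, COMMUTATOR FORM** (box root; coarse coefficient `a` BOUNDED, leg `R` with summable fine slices,
gauge function of bounded gradient): with the kernel `KΛ_sym(ψ; a; b, z) = −Σ_μ Σ'_y a μ y·((ψ z + ψ(z+e_b) − ψ(L·y+ρ) − ψ(L·y+ρ+L·e_μ))·q¹_sym,ρ_{(μ,y)}(b,z)∕2)`
of `Push3LambdaKernelCells` (there `a = c · · κ u`),
`Σ'_z Σ_b R b z · KΛ_sym(ψ; a; b, z) = −(2·((d+1)!·L^{d+1}))⁻¹ · Σ_μ Σ'_y a μ y · (symLinAvgAt ρ (ψ̄•R) L μ y − Ψ̄_ρ(μ,y) · symLinAvgAt ρ R L μ y)`. -/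
theorem tsum_sum_leg_mul_lambdaKernel (hL : 1 ≤ L) (hr : r ∈ box (d + 1) L)
    {a : Fin (d + 1) → (Fin (d + 1) → ℤ) → ℝ} {Ca : ℝ} (ha : ∀ μ y, |a μ y| ≤ Ca)
    {R : Form1 (d + 1) ℝ} (hRs : ∀ b, Summable fun z => R b z)
    {ψ : (Fin (d + 1) → ℤ) → ℝ} {G : ℝ} (hψ : ∀ κ x, |dz ψ κ x| ≤ G) :
    ∑' z, ∑ b, R b z * -(∑ μ, ∑' y, a μ y *
        ((ψ z + ψ (z + unitVec b) - ψ ((L : ℤ) • y + toSite r) - ψ ((L : ℤ) • y + toSite r + (L : ℤ) • unitVec μ))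
          * symLinKerAt (toSite r) L μ y (b, z) / 2))
      = -(2 * ((((d + 1).factorial : ℕ) : ℝ) * (L : ℝ) ^ (d + 1)))⁻¹ * ∑ μ, ∑' y, a μ y *
          (symLinAvgAt (toSite r) (fun b z => (ψ z + ψ (z + unitVec b)) * R b z) L μ y
            - (ψ ((L : ℤ) • y + toSite r) + ψ ((L : ℤ) • y + toSite r + (L : ℤ) • unitVec μ)) * symLinAvgAt (toSite r) R L μ y) := by
  have hG : 0 ≤ G := (abs_nonneg _).trans (hψ 0 0)
  -- the kernel `K μ y b z := weight · q¹ ∕ 2`: support and bound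
  have hK0 : ∀ μ y b z, ¬ Near L y z →
      (ψ z + ψ (z + unitVec b) - ψ ((L : ℤ) • y + toSite r) - ψ ((L : ℤ) • y + toSite r + (L : ℤ) • unitVec μ))
        * symLinKerAt (toSite r) L μ y (b, z) / 2 = 0 := fun μ y b z h => by
    rw [symLinKerAt_eq_zero hr (f := (b, z)) h, mul_zero, zero_div]
  have hK : ∀ μ y b z, Near L y z →
      |(ψ z + ψ (z + unitVec b) - ψ ((L : ℤ) • y + toSite r) - ψ ((L : ℤ) • y + toSite r + (L : ℤ) • unitVec μ))
        * symLinKerAt (toSite r) L μ y (b, z) / 2| ≤ G * (2 * (((d : ℝ) + 1) * (2 * (L : ℝ))) + 1) * (ell (d + 1) L : ℝ) / 2 := by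
    intro μ y b z h
    rw [abs_div, abs_two, abs_mul]
    refine div_le_div_of_nonneg_right (mul_le_mul (abs_gaugeWeight_le hr hψ (prox_of_near h) b μ)
      (abs_symLinKerAt_le hL μ y hr (b, z)) (abs_nonneg _) (by positivity)) zero_le_two
  have hx := tsum_sum_mul_sum_tsum_comm hL hK0 hK ha hRs
  -- pull the sign out, exchange, and read each inner pairing as a commutator (§2)
  have hneg : (fun z => ∑ b, R b z * -(∑ μ, ∑' y, a μ y *
      ((ψ z + ψ (z + unitVec b) - ψ ((L : ℤ) • y + toSite r) - ψ ((L : ℤ) • y + toSite r + (L : ℤ) • unitVec μ))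
        * symLinKerAt (toSite r) L μ y (b, z) / 2))) = fun z => -(∑ b, R b z * ∑ μ, ∑' y, a μ y *
      ((ψ z + ψ (z + unitVec b) - ψ ((L : ℤ) • y + toSite r) - ψ ((L : ℤ) • y + toSite r + (L : ℤ) • unitVec μ))
        * symLinKerAt (toSite r) L μ y (b, z) / 2)) := by
    funext z
    rw [← Finset.sum_neg_distrib]
    exact Finset.sum_congr rfl fun b _ => mul_neg _ _
  rw [hneg, tsum_neg, hx, neg_mul, Finset.mul_sum]
  congr 1
  refine Finset.sum_congr rfl fun μ _ => ?_
  rw [← tsum_mul_left]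
  refine tsum_congr fun y => ?_
  rw [tsum_sum_mul_gaugeWeight_mul_symLinKerAt hr ψ R μ y]
  ring

end Exchange

/-! ## §4 The Λ one-gauge cell factorises over the coarse bond: (bracket of the index leg against the coefficient) × (commutator of the leg) -/

section Cell

variable {L : ℕ} {r : Fin (d + 1) → ℕ}

/-- [folklore] **THE Λ ONE-GAUGE CELL FACTORISES OVER THE COARSE BOND** (the summable class of `Push3LambdaKernelCells.contact_lambda_eq_cells`: leg `R`
with summable fine slices, index leg `W` bounded, coefficient letter `|c μ y κ u| ≤ Cc·e^{−δ|L·y − u|₁}`, gauge function of bounded gradient; box root):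
`Σ'_z Σ_b R b z · Σ'_u Σ_κ W κ u · KΛ_sym(ψ; κ,u; b,z) = −(2·((d+1)!·L^{d+1}))⁻¹ · Σ_μ Σ'_y ⟨W, c(μ,y;·)⟩ · (symLinAvgAt ρ (ψ̄•R) L μ y − Ψ̄_ρ(μ,y) · symLinAvgAt ρ R L μ y)`,
`⟨W, c(μ,y;·)⟩ = Σ'_u Σ_κ W κ u · c μ y κ u` — the BRACKET factor is where the Lagrange coefficient is re-read as a tent of the next-level
Hessian column (the owner's `RespStepEffectiveEL.lamCoeffK_KInvStep_E2_eq_neg_contourSumAdj`, §5 below), the COMMUTATOR factor is where the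
leg climbs one level (§1's `tsum_sum_symLinKerAt_mul_eq_contourSum_sub` and the tent `RespStepEffectiveEL.HΦcol_pair_respStep`). -/
theorem cellLambda_eq_sum_bracket_mul_commutator (hL : 1 ≤ L) (hr : r ∈ box (d + 1) L)
    {c : Fin (d + 1) → (Fin (d + 1) → ℤ) → Fin (d + 1) → (Fin (d + 1) → ℤ) → ℝ} {Cc δ : ℝ}
    (hc : ∀ μ y κ u, |c μ y κ u| ≤ Cc * Real.exp (-δ * l1 ((L : ℤ) • y - u))) (hδ : 0 < δ)
    {R : Form1 (d + 1) ℝ} (hRs : ∀ b, Summable fun z => R b z)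
    {W : Form1 (d + 1) ℝ} {CW : ℝ} (hW : ∀ κ u, |W κ u| ≤ CW)
    {ψ : (Fin (d + 1) → ℤ) → ℝ} {G : ℝ} (hψ : ∀ κ x, |dz ψ κ x| ≤ G) :
    ∑' z, ∑ b, R b z * ∑' u, ∑ κ, W κ u *
        -(∑ μ, ∑' y, c μ y κ u *
          ((ψ z + ψ (z + unitVec b) - ψ ((L : ℤ) • y + toSite r) - ψ ((L : ℤ) • y + toSite r + (L : ℤ) • unitVec μ))
            * symLinKerAt (toSite r) L μ y (b, z) / 2))
      = -(2 * ((((d + 1).factorial : ℕ) : ℝ) * (L : ℝ) ^ (d + 1)))⁻¹ * ∑ μ, ∑' y, (∑' u, ∑ κ, W κ u * c μ y κ u) *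
          (symLinAvgAt (toSite r) (fun b z => (ψ z + ψ (z + unitVec b)) * R b z) L μ y
            - (ψ ((L : ℤ) • y + toSite r) + ψ ((L : ℤ) • y + toSite r + (L : ℤ) • unitVec μ)) * symLinAvgAt (toSite r) R L μ y) := by
  classical
  -- Step A: the index leg passes through the coarse sum (for each `(b, z)` the `y`-family is finitely supported)
  have hA : ∀ b z, (∑' u, ∑ κ, W κ u * -(∑ μ, ∑' y, c μ y κ u *
      ((ψ z + ψ (z + unitVec b) - ψ ((L : ℤ) • y + toSite r) - ψ ((L : ℤ) • y + toSite r + (L : ℤ) • unitVec μ))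
        * symLinKerAt (toSite r) L μ y (b, z) / 2)))
      = -(∑ μ, ∑' y, (∑' u, ∑ κ, W κ u * c μ y κ u) *
          ((ψ z + ψ (z + unitVec b) - ψ ((L : ℤ) • y + toSite r) - ψ ((L : ℤ) • y + toSite r + (L : ℤ) • unitVec μ))
            * symLinKerAt (toSite r) L μ y (b, z) / 2)) := by
    intro b z
    obtain ⟨s, -, hs, -⟩ := exists_finset_near_card (d := d) hL z
    exact tsum_sum_idxLeg_mul_neg_sum_tsum hc hδ hW s fun μ y hy => by
      rw [symLinKerAt_eq_zero hr (f := (b, z)) (fun h => hy (hs y h)), mul_zero, zero_div]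
  have hA' : (fun z => ∑ b, R b z * ∑' u, ∑ κ, W κ u * -(∑ μ, ∑' y, c μ y κ u *
      ((ψ z + ψ (z + unitVec b) - ψ ((L : ℤ) • y + toSite r) - ψ ((L : ℤ) • y + toSite r + (L : ℤ) • unitVec μ))
        * symLinKerAt (toSite r) L μ y (b, z) / 2))) = fun z => ∑ b, R b z * -(∑ μ, ∑' y, (∑' u, ∑ κ, W κ u * c μ y κ u) *
      ((ψ z + ψ (z + unitVec b) - ψ ((L : ℤ) • y + toSite r) - ψ ((L : ℤ) • y + toSite r + (L : ℤ) • unitVec μ))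
        * symLinKerAt (toSite r) L μ y (b, z) / 2)) := by
    funext z
    exact Finset.sum_congr rfl fun b _ => by rw [hA b z]
  rw [hA']
  -- Step B: §3 with the bracket as the coarse coefficient
  exact tsum_sum_leg_mul_lambdaKernel hL hr (abs_bracket_le hc hδ hW) hRs hψ

/-- [folklore] **THE SOCKET RE-READ: `contact_lambda_eq_cells`' TWO Λ CELLS, FACTORISED** (same hypotheses as `Push3LambdaKernelCells.contact_lambda_eq_cells`; the gradient letters of
`λ_L`, `λ_R` are the leg bounds through `lᴱ − lᴮ = dz λ_L`, `rᴱ − rᴮ = dz λ_R`):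
`push₃ lᴱ rᴱ wᴱ SΛ − push₃ lᴮ rᴮ wᴮ SΛ` `(x′,z′,inl α,inl β)`
`= −(2·((d+1)!·L^{d+1}))⁻¹·Σ_μ Σ'_y ⟨wᴱ_{κ′u′}, c(μ,y;·)⟩·[𝒬^ρ_{L,sym}, λ̄_L αx′] rᴱ_{βz′} (μ,y) + (2·((d+1)!·L^{d+1}))⁻¹·Σ_μ Σ'_y ⟨wᴱ_{κ′u′}, c(μ,y;·)⟩·[𝒬^ρ_{L,sym}, λ̄_R βz′] lᴮ_{αx′} (μ,y)` (written as the difference of the two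
factorised cells). -/
theorem contact_lambda_eq_factorised {lE lB rE rB wE wB : Fin (d + 1) → (Fin (d + 1) → ℤ) → Fin (d + 1) → (Fin (d + 1) → ℤ) → ℝ}
    {lamL lamR lamW : Fin (d + 1) → (Fin (d + 1) → ℤ) → (Fin (d + 1) → ℤ) → ℝ} {ClE ClB CrE CrB CwE CwB ClamW : ℝ}
    {rr : Fin (d + 1) → ℕ} {c : Fin (d + 1) → (Fin (d + 1) → ℤ) → Fin (d + 1) → (Fin (d + 1) → ℤ) → ℝ} {Cc δ : ℝ}
    (hL : 1 ≤ L) (hrr : rr ∈ box (d + 1) L) (hc : ∀ μ y κ u, |c μ y κ u| ≤ Cc * Real.exp (-δ * l1 ((L : ℤ) • y - u)))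
    (hδ : 0 < δ) (hCc : 0 ≤ Cc) (hdiv : ∀ u, divV (SLam L c (fun μ y => symHessFFAt (toSite rr) L μ y)) u = 0)
    (hlE : ∀ α x' κ x, |lE α x' κ x| ≤ ClE) (hlEs : ∀ α x' κ, Summable fun x => lE α x' κ x)
    (hlB : ∀ α x' κ x, |lB α x' κ x| ≤ ClB) (hlBs : ∀ α x' κ, Summable fun x => lB α x' κ x)
    (hrE : ∀ β z' κ z, |rE β z' κ z| ≤ CrE) (hrEs : ∀ β z' κ, Summable fun z => rE β z' κ z)
    (hrB : ∀ β z' κ z, |rB β z' κ z| ≤ CrB) (hrBs : ∀ β z' κ, Summable fun z => rB β z' κ z)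
    (hwE : ∀ κ' u' κ u, |wE κ' u' κ u| ≤ CwE) (hwB : ∀ κ' u' κ u, |wB κ' u' κ u| ≤ CwB)
    (hLg : lE - lB = fun μ y κ u => dz (lamL μ y) κ u) (hRg : rE - rB = fun μ y κ u => dz (lamR μ y) κ u)
    (hWg : wE - wB = fun μ y κ u => dz (lamW μ y) κ u) (hlamW : ∀ μ y u, |lamW μ y u| ≤ ClamW)
    (κ' : Fin (d + 1)) (u' x' z' : Fin (d + 1) → ℤ) (α β : Fin (d + 1)) :
    push₃ lE rE wE (SLam L c (fun μ y => symHessFFAt (toSite rr) L μ y)) κ' u' x' z' (Sum.inl α) (Sum.inl β)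
        - push₃ lB rB wB (SLam L c (fun μ y => symHessFFAt (toSite rr) L μ y)) κ' u' x' z' (Sum.inl α) (Sum.inl β)
      = -(2 * ((((d + 1).factorial : ℕ) : ℝ) * (L : ℝ) ^ (d + 1)))⁻¹ * (∑ μ, ∑' y, (∑' u, ∑ κ, wE κ' u' κ u * c μ y κ u) *
            (symLinAvgAt (toSite rr) (fun b z => (lamL α x' z + lamL α x' (z + unitVec b)) * rE β z' b z) L μ y
              - (lamL α x' ((L : ℤ) • y + toSite rr) + lamL α x' ((L : ℤ) • y + toSite rr + (L : ℤ) • unitVec μ))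
                * symLinAvgAt (toSite rr) (rE β z') L μ y))
        - -(2 * ((((d + 1).factorial : ℕ) : ℝ) * (L : ℝ) ^ (d + 1)))⁻¹ * (∑ μ, ∑' y, (∑' u, ∑ κ, wE κ' u' κ u * c μ y κ u) *
            (symLinAvgAt (toSite rr) (fun a x => (lamR β z' x + lamR β z' (x + unitVec a)) * lB α x' a x) L μ y
              - (lamR β z' ((L : ℤ) • y + toSite rr) + lamR β z' ((L : ℤ) • y + toSite rr + (L : ℤ) • unitVec μ))
                * symLinAvgAt (toSite rr) (lB α x') L μ y)) := by
  -- the gradient letters of the gauge functions from the leg bounds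
  have hgL : ∀ κ u, |dz (lamL α x') κ u| ≤ ClE + ClB := fun κ u => by
    have e : dz (lamL α x') κ u = (lE - lB) α x' κ u := by rw [hLg]
    rw [e, Pi.sub_apply, Pi.sub_apply, Pi.sub_apply, Pi.sub_apply]
    exact (abs_sub _ _).trans (add_le_add (hlE α x' κ u) (hlB α x' κ u))
  have hgR : ∀ κ u, |dz (lamR β z') κ u| ≤ CrE + CrB := fun κ u => by
    have e : dz (lamR β z') κ u = (rE - rB) β z' κ u := by rw [hRg]
    rw [e, Pi.sub_apply, Pi.sub_apply, Pi.sub_apply, Pi.sub_apply]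
    exact (abs_sub _ _).trans (add_le_add (hrE β z' κ u) (hrB β z' κ u))
  rw [contact_lambda_eq_cells hL hrr hc hδ hCc hdiv hlE hlEs hlB hlBs hrE hrEs hrB hrBs hwE hwB hLg hRg hWg hlamW,
    cellLambda_eq_sum_bracket_mul_commutator hL hrr hc hδ (R := rE β z') (hrEs β z') (W := wE κ' u') (hwE κ' u') hgL,
    cellLambda_eq_sum_bracket_mul_commutator hL hrr hc hδ (R := lB α x') (hlBs α x') (W := wE κ' u') (hwE κ' u') hgR]

end Cell


end Summit.QuantumFields.BalabanUV.Beta.GAN24.SymContactLambdaCellFactorised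

end
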